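import Summits.NavierStokesRegularity.NavierStokesRegularity.Theorems.TypeICertificateLadderTargetRotationDefectLiouville
import HarnessLib

/-!
# Route TypeICertificateLadder — crux `Target` (item stmt-NavierStokesRegularity-1217),
# line `killing-twisted-bernoulli-solitons`: the axisymmetric stratum of the window stub B5b

Support file (theorems only, `--supports stmt-NavierStokesRegularity-1217`), stub
`rssStratum_axisymmetric`. Stub B5b of this line is Pineau–Vicol's Conjecture 1.1
(arXiv:2607.09619) in the window `α ≈ 1`: a Type-I rotated self-similar (RSS) classical solution
`u = pvAnsatz α U` on `[−1, 0)` with `‖u(t, x)‖ ≤ C₀ / (‖x‖ + √(−t))` is trivial. This file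
records its AXISYMMETRIC STRATUM, in the all-quantified shape registered for the skeleton of the
crux: if the profile `U` is axisymmetric about the rotation axis (`U (R_θ y) = R_θ (U y)`,
`IsAxisymmetric U`; §1.2 p. 5 of the source: "the kernel of `R` consists of axisymmetric vector
fields"), then `U = 0` — at EVERY speed `α` and for EVERY constant `C₀` (no positivity is
assumed: a non-positive Type-I constant is enlarged to `max C₀ 1`).

The proof is the tree's rotation-defect stratum `rotationDefect_axisymmetric`
(`TypeICertificateLadderTargetRotationDefectLiouville`: the rotation defect `RU = JU − DU(Jy)`
of an axisymmetric profile vanishes identically, so the unconditional small-defect Liouville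
theorem `rotationDefect_liouville` — Pineau–Vicol's §6 endgame through the weighted gap lemma —
applies). An independent route, not taken here, is KNSS 2009, Thm. 5.3
(`KNSS2009_liouville_bound_C_over_r_holds`) applied to a time shift of the backward extension of
the ansatz field, whose slices are axisymmetric with `r ‖u‖ ≤ C₀`.

## References

* B. Pineau, V. Vicol, arXiv:2607.09619 (2026): Conjecture 1.1, Thm. 1.4 (p. 4), §1.2 (p. 5).
  [PineauVicol2026]
* G. Koch, N. Nadirashvili, G. Seregin, V. Šverák, Acta Math. 203 (2009), Thm. 5.3.
  [KochNadirashviliSereginSverak2009]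
-/

noncomputable section

-- the summit and its single sub-problem share the name (CONVENTIONS §1), as in every Theorems file
set_option linter.dupNamespace false

namespace Summit.NavierStokesRegularity.NavierStokesRegularity.Theorems

open Set Function
open Literature.Analysis.FluidPDE

/-- **The axisymmetric stratum of the window Liouville problem (all speeds, all constants).**
If `(u, p)` is a classical Navier–Stokes solution (`ν = 1`, `f = 0`) on `[−1, 0)` with the Type-I
bound `‖u(t, x)‖ ≤ C₀ / (‖x‖ + √(−t))`, and `u` is the Pineau–Vicol rotated self-similar ansatz
`pvAnsatz α U` of a `C²` profile `U` which is axisymmetric about the rotation axis, then `U = 0`.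
Proof: enlarge the constant to `max C₀ 1 > 0` and apply the rotation-defect stratum
`rotationDefect_axisymmetric` (the profile regularity `U ∈ C²` is not used). [cite: PineauVicol2026, §1.2 (p. 5: "the kernel of R consists of axisymmetric vector fields") and Thm. 1.4 (p. 4)] -/
theorem rssStratum_axisymmetric :
    ∀ (C₀ α : ℝ) (u : ℝ → EuclideanSpace ℝ (Fin 3) → EuclideanSpace ℝ (Fin 3))
      (p : ℝ → EuclideanSpace ℝ (Fin 3) → ℝ) (U : EuclideanSpace ℝ (Fin 3) → EuclideanSpace ℝ (Fin 3)),
      Literature.Analysis.FluidPDE.IsClassicalNSSolutionOn (Set.Ico (-1) 0) 1 0 u p →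
      (∀ t ∈ Set.Ico (-1 : ℝ) 0, ∀ x : EuclideanSpace ℝ (Fin 3), ‖u t x‖ ≤ C₀ / (‖x‖ + Real.sqrt (-t))) →
      ContDiff ℝ 2 U →
      (∀ t ∈ Set.Ico (-1 : ℝ) 0, ∀ x : EuclideanSpace ℝ (Fin 3),
        u t x = Literature.Analysis.FluidPDE.pvAnsatz α (fun y _ => U y) t x) →
      Literature.Analysis.FluidPDE.IsAxisymmetric U → U = 0 := by
  intro C₀ α u p U hsol hI _hU hans hax
  -- enlarge the Type-I constant to a positive one
  have hI' : ∀ t ∈ Set.Ico (-1 : ℝ) 0, ∀ x : EuclideanSpace ℝ (Fin 3),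
      ‖u t x‖ ≤ max C₀ 1 / (‖x‖ + Real.sqrt (-t)) := fun t ht x =>
    (hI t ht x).trans (div_le_div_of_nonneg_right (le_max_left _ _) (by positivity))
  exact rotationDefect_axisymmetric (lt_max_of_lt_right one_pos) hsol hI' hans hax

/-- Signature probe: the statement registered for the stub. -/
example : ∀ (C₀ α : ℝ) (u : ℝ → EuclideanSpace ℝ (Fin 3) → EuclideanSpace ℝ (Fin 3)) (p : ℝ → EuclideanSpace ℝ (Fin 3) → ℝ) (U : EuclideanSpace ℝ (Fin 3) → EuclideanSpace ℝ (Fin 3)), Literature.Analysis.FluidPDE.IsClassicalNSSolutionOn (Set.Ico (-1) 0) 1 0 u p → (∀ t ∈ Set.Ico (-1 : ℝ) 0, ∀ x : EuclideanSpace ℝ (Fin 3), ‖u t x‖ ≤ C₀ / (‖x‖ + Real.sqrt (-t))) → ContDiff ℝ 2 U → (∀ t ∈ Set.Ico (-1 : ℝ) 0, ∀ x : EuclideanSpace ℝ (Fin 3), u t x = Literature.Analysis.FluidPDE.pvAnsatz α (fun y _ => U y) t x) → Literature.Analysis.FluidPDE.IsAxisymmetric U → U = 0 :=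
  rssStratum_axisymmetric

end Summit.NavierStokesRegularity.NavierStokesRegularity.Theorems

end
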